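import Summits.RiemannHypothesis.RiemannHypothesis.Theorems.WeilFormatCCinfHankelFarCrude
import HarnessLib

/-!
# Format C, design C∞ (E2c, data side): FAR TAILS of the Hankel entries, part 3 — trig × trig pairs by product-to-sum

Continuation of `WeilFormatCCinfHankelFar` / `…FarCrude` (namespace `CinfHankelR`; supporting stmt-RiemannHypothesis-0098; seat
rh-explicit-weil-2): `tsum_coscos_far`/`tsum_sinsin_far`/`tsum_cossin_far` (product-to-sum under the far sum), `diffFarBox`/`trigPairList`
(+ `mem_…`: per frequency pair the (difference, sum)-phase trig tails by `trigFarScaledBox`, the diagonal difference by `pureFarScaledBox`),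
`pairSum`/`combCC/combSS/combCS` and `mem_far22`/`mem_far33`/`mem_far23` — the pairs `(C,C)`, `(S,S)`, `(C,S)` as double weighted sums
over the prime list.

Interval bookkeeping over landed evaluators; standard axioms; no RH claim.
-/

-- `Summit.RiemannHypothesis.RiemannHypothesis.…` is the layout-mandated namespace (summit = problem name).
set_option linter.dupNamespace false

open Finset
open scoped Real ArithmeticFunction.vonMangoldt

namespace Summit.RiemannHypothesis.RiemannHypothesis.Theorems.WeilFormatC

namespace CinfHankelR

open Literature.NumberTheory.LFunctions Literature.NumberTheory.LFunctions.Yoshida1992 Literature.Analysis.SpecialFunctions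
open Literature.Analysis.ValidatedNumerics Literature.Analysis.ValidatedNumerics.NumericsMP
open Encl (Consts ConstsValid)
open WinEntry (sumBox mem_sumBox)
open CinfCoeff (pureFarScaledBox mem_pureFarScaledBox logFarScaledBox mem_logFarScaledBox logSqFarScaledBox mem_logSqFarScaledBox
  trigFarScaledBox mem_trigFarScaledBox)

variable {S : ℕ} {a : ℝ} {ks : List PrimeLen} {C : Consts}

/-! ## Trig × trig by product-to-sum -/

/-- pulling the rescaling factor `(m₀/B₄)^s` out of a far sum. -/
private theorem rescale_fun (f : ℕ → ℝ) (m₀ B₄ s : ℕ) :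
    (fun k : ℕ ↦ f k * ((m₀ : ℝ) / ((B₄ + k : ℕ) : ℝ)) ^ s) = fun k : ℕ ↦ (m₀ : ℝ) ^ s * (f k / (((B₄ + k : ℕ)) : ℝ) ^ s) := by
  funext k; rw [div_pow]; ring

/-- `Σ' cos·cos·r^s` by product-to-sum (rescaled form of `tsum_cos_mul_cos_div_pow`). -/
theorem tsum_coscos_far (φ ψ : ℝ) {s : ℕ} (hs : 2 ≤ s) (m₀ B₄ : ℕ) :
    ∑' k : ℕ, Real.cos ((B₄ + k : ℕ) * φ) * Real.cos ((B₄ + k : ℕ) * ψ) * ((m₀ : ℝ) / ((B₄ + k : ℕ) : ℝ)) ^ s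
      = ((∑' k : ℕ, Real.cos ((B₄ + k : ℕ) * (φ - ψ)) * ((m₀ : ℝ) / ((B₄ + k : ℕ) : ℝ)) ^ s)
          + ∑' k : ℕ, Real.cos ((B₄ + k : ℕ) * (φ + ψ)) * ((m₀ : ℝ) / ((B₄ + k : ℕ) : ℝ)) ^ s) / 2 := by
  rw [rescale_fun (fun k ↦ Real.cos ((B₄ + k : ℕ) * φ) * Real.cos ((B₄ + k : ℕ) * ψ)),
    rescale_fun (fun k ↦ Real.cos ((B₄ + k : ℕ) * (φ - ψ))), rescale_fun (fun k ↦ Real.cos ((B₄ + k : ℕ) * (φ + ψ))),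
    tsum_mul_left, tsum_mul_left, tsum_mul_left, tsum_cos_mul_cos_div_pow φ ψ hs B₄]
  ring

/-- `Σ' sin·sin·r^s` by product-to-sum. -/
theorem tsum_sinsin_far (φ ψ : ℝ) {s : ℕ} (hs : 2 ≤ s) (m₀ B₄ : ℕ) :
    ∑' k : ℕ, Real.sin ((B₄ + k : ℕ) * φ) * Real.sin ((B₄ + k : ℕ) * ψ) * ((m₀ : ℝ) / ((B₄ + k : ℕ) : ℝ)) ^ s
      = ((∑' k : ℕ, Real.cos ((B₄ + k : ℕ) * (φ - ψ)) * ((m₀ : ℝ) / ((B₄ + k : ℕ) : ℝ)) ^ s)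
          - ∑' k : ℕ, Real.cos ((B₄ + k : ℕ) * (φ + ψ)) * ((m₀ : ℝ) / ((B₄ + k : ℕ) : ℝ)) ^ s) / 2 := by
  rw [rescale_fun (fun k ↦ Real.sin ((B₄ + k : ℕ) * φ) * Real.sin ((B₄ + k : ℕ) * ψ)),
    rescale_fun (fun k ↦ Real.cos ((B₄ + k : ℕ) * (φ - ψ))), rescale_fun (fun k ↦ Real.cos ((B₄ + k : ℕ) * (φ + ψ))),
    tsum_mul_left, tsum_mul_left, tsum_mul_left, tsum_sin_mul_sin_div_pow φ ψ hs B₄]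
  ring

/-- `Σ' cos(mφ)·sin(mψ)·r^s = (Σ' sin(m(φ+ψ)) r^s − Σ' sin(m(φ−ψ)) r^s)/2`. -/
theorem tsum_cossin_far (φ ψ : ℝ) {s : ℕ} (hs : 2 ≤ s) (m₀ B₄ : ℕ) :
    ∑' k : ℕ, Real.cos ((B₄ + k : ℕ) * φ) * Real.sin ((B₄ + k : ℕ) * ψ) * ((m₀ : ℝ) / ((B₄ + k : ℕ) : ℝ)) ^ s
      = ((∑' k : ℕ, Real.sin ((B₄ + k : ℕ) * (φ + ψ)) * ((m₀ : ℝ) / ((B₄ + k : ℕ) : ℝ)) ^ s)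
          - ∑' k : ℕ, Real.sin ((B₄ + k : ℕ) * (φ - ψ)) * ((m₀ : ℝ) / ((B₄ + k : ℕ) : ℝ)) ^ s) / 2 := by
  have h := tsum_sin_mul_cos_div_pow ψ φ hs B₄
  have e1 : (fun k : ℕ ↦ Real.sin ((B₄ + k : ℕ) * ψ) * Real.cos ((B₄ + k : ℕ) * φ) / (((B₄ + k : ℕ)) : ℝ) ^ s)
      = fun k : ℕ ↦ Real.cos ((B₄ + k : ℕ) * φ) * Real.sin ((B₄ + k : ℕ) * ψ) / (((B₄ + k : ℕ)) : ℝ) ^ s := by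
    funext k; ring
  have e2 : (fun k : ℕ ↦ Real.sin ((B₄ + k : ℕ) * (ψ - φ)) / (((B₄ + k : ℕ)) : ℝ) ^ s)
      = fun k : ℕ ↦ -(Real.sin ((B₄ + k : ℕ) * (φ - ψ)) / (((B₄ + k : ℕ)) : ℝ) ^ s) := by
    funext k; rw [show ((B₄ + k : ℕ) : ℝ) * (ψ - φ) = -(((B₄ + k : ℕ) : ℝ) * (φ - ψ)) by ring, Real.sin_neg]; ring
  rw [e1, e2, tsum_neg, show ψ + φ = φ + ψ by ring] at h
  rw [rescale_fun (fun k ↦ Real.cos ((B₄ + k : ℕ) * φ) * Real.sin ((B₄ + k : ℕ) * ψ)),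
    rescale_fun (fun k ↦ Real.sin ((B₄ + k : ℕ) * (φ + ψ))), rescale_fun (fun k ↦ Real.sin ((B₄ + k : ℕ) * (φ - ψ))),
    tsum_mul_left, tsum_mul_left, tsum_mul_left, h]
  ring

/-- The difference-frequency far boxes of the pair `(i, j)`: K-fold Abel at `φ_i − φ_j` for `i ≠ j`; on the diagonal the
frequency is `0`, so the cosine tail is the pure tail (Hurwitz E–M, `J`, `ν`) and the sine tail vanishes. -/
def diffFarBox (S Ke ke : ℕ) (C : Consts) (i j m₀ B₄ s K J ν : ℕ) : Option (MI × MI) :=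
  if i = j then some (pureFarScaledBox S m₀ B₄ s J ν, MI.ofInt S 0)
  else trigFarScaledBox S Ke ke C.P ((phaseBox S C i).sub (phaseBox S C j)) m₀ B₄ s K

/-- The list of per-frequency-PAIR far boxes: entry `i·n + j` = `(diffFarBox i j, trigFar(φ_i + φ_j))`. -/
def trigPairList (S Ke ke : ℕ) (C : Consts) (nks m₀ B₄ s K J ν : ℕ) : Option (List ((MI × MI) × (MI × MI))) :=
  Encl.omap (fun p ↦
    match diffFarBox S Ke ke C (p / nks) (p % nks) m₀ B₄ s K J ν,
          trigFarScaledBox S Ke ke C.P ((phaseBox S C (p / nks)).add (phaseBox S C (p % nks))) m₀ B₄ s K with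
    | some D, some E => some (D, E)
    | _, _ => none) (List.range (nks * nks))

/-- What `diffFarBox` encloses. -/
theorem mem_diffFarBox (hS : 0 < S) (hC : ConstsValid S a ks C) {Ke ke m₀ B₄ s K J ν : ℕ} (hB₄ : 1 ≤ B₄) (hs : 2 ≤ s)
    (hK : 1 ≤ K) (hKe : Even K) (hν : ν ≠ 0) {i j : ℕ} (hi : i < ks.length) (hj : j < ks.length) {D : MI × MI}
    (hD : diffFarBox S Ke ke C i j m₀ B₄ s K J ν = some D) :
    MI.mem S (∑' k : ℕ, Real.cos ((B₄ + k : ℕ) * (π * (ks.getD i default).len / a - π * (ks.getD j default).len / a))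
        * ((m₀ : ℝ) / ((B₄ + k : ℕ) : ℝ)) ^ s) D.1 ∧
      MI.mem S (∑' k : ℕ, Real.sin ((B₄ + k : ℕ) * (π * (ks.getD i default).len / a - π * (ks.getD j default).len / a))
        * ((m₀ : ℝ) / ((B₄ + k : ℕ) : ℝ)) ^ s) D.2 := by
  unfold diffFarBox at hD
  by_cases hij : i = j
  · subst hij
    rw [if_pos rfl, Option.some.injEq] at hD
    subst hD
    have h0 : ∀ k : ℕ, ((B₄ + k : ℕ) : ℝ) * (π * (ks.getD i default).len / a - π * (ks.getD i default).len / a) = 0 :=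
      fun k ↦ by ring
    simp only [h0, Real.cos_zero, Real.sin_zero, one_mul, zero_mul, tsum_zero]
    exact ⟨mem_pureFarScaledBox (S := S) (m₀ := m₀) (by omega) hs J hν, by simpa using MI.mem_ofInt S 0⟩
  · rw [if_neg hij] at hD
    exact mem_trigFarScaledBox hS hC.pi (MI.mem_sub (mem_phaseBox hS hC hi) (mem_phaseBox hS hC hj)) hB₄ hs hK hKe
      (show trigFarScaledBox S Ke ke C.P ((phaseBox S C i).sub (phaseBox S C j)) m₀ B₄ s K = some (D.1, D.2) by rw [hD])

/-- What the `(i, j)` entry of `trigPairList` encloses (the four tails at `φ_i ∓ φ_j`). -/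
theorem mem_trigPairList (hS : 0 < S) (hC : ConstsValid S a ks C) {Ke ke m₀ B₄ s K J ν : ℕ} (hB₄ : 1 ≤ B₄) (hs : 2 ≤ s)
    (hK : 1 ≤ K) (hKe : Even K) (hν : ν ≠ 0) {L : List ((MI × MI) × (MI × MI))}
    (hL : trigPairList S Ke ke C ks.length m₀ B₄ s K J ν = some L) {i j : ℕ} (hi : i < ks.length) (hj : j < ks.length) :
    (MI.mem S (∑' k : ℕ, Real.cos ((B₄ + k : ℕ) * (π * (ks.getD i default).len / a - π * (ks.getD j default).len / a))
          * ((m₀ : ℝ) / ((B₄ + k : ℕ) : ℝ)) ^ s) (L.getD (i * ks.length + j) default).1.1 ∧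
      MI.mem S (∑' k : ℕ, Real.sin ((B₄ + k : ℕ) * (π * (ks.getD i default).len / a - π * (ks.getD j default).len / a))
          * ((m₀ : ℝ) / ((B₄ + k : ℕ) : ℝ)) ^ s) (L.getD (i * ks.length + j) default).1.2) ∧
    (MI.mem S (∑' k : ℕ, Real.cos ((B₄ + k : ℕ) * (π * (ks.getD i default).len / a + π * (ks.getD j default).len / a))
          * ((m₀ : ℝ) / ((B₄ + k : ℕ) : ℝ)) ^ s) (L.getD (i * ks.length + j) default).2.1 ∧
      MI.mem S (∑' k : ℕ, Real.sin ((B₄ + k : ℕ) * (π * (ks.getD i default).len / a + π * (ks.getD j default).len / a))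
          * ((m₀ : ℝ) / ((B₄ + k : ℕ) : ℝ)) ^ s) (L.getD (i * ks.length + j) default).2.2) := by
  obtain ⟨_, hiL⟩ := Encl.omap_spec hL
  set p := i * ks.length + j with hp
  have hn : 0 < ks.length := by omega
  have hpl : p < ks.length * ks.length := by
    calc p = i * ks.length + j := rfl
      _ < i * ks.length + ks.length := by omega
      _ = (i + 1) * ks.length := by ring
      _ ≤ ks.length * ks.length := Nat.mul_le_mul_right _ (by omega)
  have hp' : p < (List.range (ks.length * ks.length)).length := by simpa using hpl
  have hdiv : p / ks.length = i := by
    rw [hp, Nat.add_comm, Nat.add_mul_div_right _ _ hn, Nat.div_eq_of_lt hj, Nat.zero_add]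
  have hmod : p % ks.length = j := by
    rw [hp, Nat.add_comm, Nat.add_mul_mod_self_right, Nat.mod_eq_of_lt hj]
  have e := hiL p hp'
  rw [List.getD_eq_getElem?_getD, List.getElem?_range hpl, Option.getD_some, hdiv, hmod] at e
  have hφi := mem_phaseBox hS hC hi
  have hφj := mem_phaseBox hS hC hj
  split at e
  · rename_i D E hD hE
    simp only [Option.some.injEq] at e
    have hDm := mem_diffFarBox hS hC hB₄ hs hK hKe hν hi hj hD
    have hEm := mem_trigFarScaledBox hS hC.pi (MI.mem_add hφi hφj) hB₄ hs hK hKe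
      (show trigFarScaledBox S Ke ke C.P ((phaseBox S C i).add (phaseBox S C j)) m₀ B₄ s K = some (E.1, E.2) by rw [hE])
    rw [← e]
    exact ⟨hDm, hEm⟩
  · simp at e

/-- The pair weights and the three trig×trig combinations as boxes: `Σ_{i,j<n} W_i W_j · comb(L_{i n + j})`. -/
def pairSum (S : ℕ) (W : List MI) (L : List ((MI × MI) × (MI × MI))) (n : ℕ) (comb : (MI × MI) × (MI × MI) → MI) : MI :=
  sumBox S (fun i ↦ sumBox S (fun j ↦ (((W.getD i default).mul S (W.getD j default)).mul S (comb (L.getD (i * n + j) default))).divNat 2) n) n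

/-- The three combinations: `cc = D.1 + E.1`, `ss = D.1 − E.1`, `cs = E.2 − D.2`. -/
def combCC (x : (MI × MI) × (MI × MI)) : MI := x.1.1.add x.2.1
/-- combination for the pair `(3,3)`: `cos(diff) − cos(sum)` parts. -/
def combSS (x : (MI × MI) × (MI × MI)) : MI := x.1.1.sub x.2.1
/-- combination for the pair `(2,3)`: `sin(sum) − sin(diff)` parts. -/
def combCS (x : (MI × MI) × (MI × MI)) : MI := x.2.2.sub x.1.2

/-- Summability of `w · trig(mφ) trig'(mψ) r^s`-type terms (bounded by `r^s`). -/
private theorem summable_bdd_far {f : ℕ → ℝ} (hf : ∀ k, |f k| ≤ 1) {s : ℕ} (hs : 2 ≤ s) (m₀ B₄ : ℕ) :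
    Summable fun k : ℕ ↦ f k * ((m₀ : ℝ) / ((B₄ + k : ℕ) : ℝ)) ^ s := by
  have hsumP : Summable fun k : ℕ ↦ ((m₀ : ℝ) / ((B₄ + k : ℕ) : ℝ)) ^ s :=
    (summable_cos_far 0 hs m₀ B₄).congr fun k ↦ by simp
  refine Summable.of_norm_bounded hsumP fun k ↦ ?_
  rw [Real.norm_eq_abs, abs_mul, abs_of_nonneg (by positivity : (0 : ℝ) ≤ ((m₀ : ℝ) / ((B₄ + k : ℕ) : ℝ)) ^ s)]
  exact mul_le_of_le_one_left (by positivity) (hf k)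

/-- The generic double-sum rearrangement: `Σ' (Σ_i w_i g_i(m)) (Σ_j w_j h_j(m)) r^s = Σ_i Σ_j w_i w_j Σ' g_i h_j r^s`
for bounded `g`, `h`. -/
private theorem tsum_double (w : ℕ → ℝ) (g h : ℕ → ℕ → ℝ) (hg : ∀ i m, |g i m| ≤ 1) (hh : ∀ j m, |h j m| ≤ 1) (n : ℕ)
    {s : ℕ} (hs : 2 ≤ s) (m₀ B₄ : ℕ) :
    ∑' k : ℕ, (∑ i ∈ Finset.range n, w i * g i (B₄ + k)) * (∑ j ∈ Finset.range n, w j * h j (B₄ + k))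
        * ((m₀ : ℝ) / ((B₄ + k : ℕ) : ℝ)) ^ s
      = ∑ i ∈ Finset.range n, ∑ j ∈ Finset.range n, w i * w j *
          ∑' k : ℕ, g i (B₄ + k) * h j (B₄ + k) * ((m₀ : ℝ) / ((B₄ + k : ℕ) : ℝ)) ^ s := by
  have hterm : ∀ k : ℕ, (∑ i ∈ Finset.range n, w i * g i (B₄ + k)) * (∑ j ∈ Finset.range n, w j * h j (B₄ + k))
        * ((m₀ : ℝ) / ((B₄ + k : ℕ) : ℝ)) ^ s
      = ∑ i ∈ Finset.range n, ∑ j ∈ Finset.range n,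
          w i * w j * (g i (B₄ + k) * h j (B₄ + k) * ((m₀ : ℝ) / ((B₄ + k : ℕ) : ℝ)) ^ s) := by
    intro k
    rw [Finset.sum_mul_sum, Finset.sum_mul]
    refine Finset.sum_congr rfl fun i _ ↦ ?_
    rw [Finset.sum_mul]
    refine Finset.sum_congr rfl fun j _ ↦ ?_
    ring
  have hsum1 : ∀ i j : ℕ, Summable fun k : ℕ ↦
      w i * w j * (g i (B₄ + k) * h j (B₄ + k) * ((m₀ : ℝ) / ((B₄ + k : ℕ) : ℝ)) ^ s) := by
    intro i j
    refine (summable_bdd_far (f := fun k ↦ g i (B₄ + k) * h j (B₄ + k)) (fun k ↦ ?_) hs m₀ B₄).mul_left _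
    rw [abs_mul]
    exact mul_le_one₀ (hg i _) (abs_nonneg _) (hh j _)
  simp_rw [hterm]
  rw [Summable.tsum_finsetSum (fun i _ ↦ summable_sum fun j _ ↦ hsum1 i j)]
  refine Finset.sum_congr rfl fun i _ ↦ ?_
  rw [Summable.tsum_finsetSum (fun j _ ↦ hsum1 i j)]
  refine Finset.sum_congr rfl fun j _ ↦ ?_
  exact tsum_mul_left

/-- The cosine sum at a natural mode as a range sum with per-frequency phases. -/
private theorem C_eq (hks : PrimeData a ks) (m : ℕ) :
    (∑ n ∈ weilPrimeIndex a, (Λ n : ℝ) / Real.sqrt n * Real.cos (π * m / a * Real.log n))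
      = ∑ i ∈ Finset.range ks.length, (ks.getD i default).wt * Real.cos (m * (π * (ks.getD i default).len / a)) := by
  rw [Encl.sum_weilPrimeIndex_eq_listSum hks, Encl.list_sum_map_eq_sum_range]
  refine Finset.sum_congr rfl fun i _ ↦ ?_
  rw [PrimeLen.log_val]; ring_nf

/-- `S_m` as the weighted list sum over the prime records. -/
private theorem S_eq (hks : PrimeData a ks) (m : ℕ) :
    (∑ n ∈ weilPrimeIndex a, (Λ n : ℝ) / Real.sqrt n * Real.sin (π * m / a * Real.log n))
      = ∑ i ∈ Finset.range ks.length, (ks.getD i default).wt * Real.sin (m * (π * (ks.getD i default).len / a)) := by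
  rw [Encl.sum_weilPrimeIndex_eq_listSum hks, Encl.list_sum_map_eq_sum_range]
  refine Finset.sum_congr rfl fun i _ ↦ ?_
  rw [PrimeLen.log_val]; ring_nf

/-- ★ `far22 ∋ farSum (2,2)`. -/
theorem mem_far22 (hS : 0 < S) (hks : PrimeData a ks) (hC : ConstsValid S a ks C) {Ke ke m₀ B₄ s K J ν : ℕ} (hB₄ : 1 ≤ B₄)
    (hs : 2 ≤ s) (hK : 1 ≤ K) (hKe : Even K) (hν : ν ≠ 0) {L : List ((MI × MI) × (MI × MI))}
    (hL : trigPairList S Ke ke C ks.length m₀ B₄ s K J ν = some L) :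
    MI.mem S (farSum a m₀ B₄ 2 2 s) (pairSum S C.wts L ks.length combCC) := by
  have e : farSum a m₀ B₄ 2 2 s = ∑ i ∈ Finset.range ks.length, ∑ j ∈ Finset.range ks.length,
      (ks.getD i default).wt * (ks.getD j default).wt *
        (((∑' k : ℕ, Real.cos ((B₄ + k : ℕ) * (π * (ks.getD i default).len / a - π * (ks.getD j default).len / a))
              * ((m₀ : ℝ) / ((B₄ + k : ℕ) : ℝ)) ^ s)
          + ∑' k : ℕ, Real.cos ((B₄ + k : ℕ) * (π * (ks.getD i default).len / a + π * (ks.getD j default).len / a))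
              * ((m₀ : ℝ) / ((B₄ + k : ℕ) : ℝ)) ^ s) / 2) := by
    unfold farSum
    have hterm : ∀ k : ℕ, tagT a 2 (B₄ + k) * tagT a 2 (B₄ + k) * ((m₀ : ℝ) / ((B₄ + k : ℕ) : ℝ)) ^ s
        = (∑ i ∈ Finset.range ks.length, (ks.getD i default).wt * Real.cos (((B₄ + k : ℕ) : ℝ) * (π * (ks.getD i default).len / a)))
          * (∑ j ∈ Finset.range ks.length, (ks.getD j default).wt * Real.cos (((B₄ + k : ℕ) : ℝ) * (π * (ks.getD j default).len / a)))
          * ((m₀ : ℝ) / ((B₄ + k : ℕ) : ℝ)) ^ s := by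
      intro k; rw [tagT_two, C_eq hks, neg_mul_neg]
    simp_rw [hterm]
    rw [tsum_double (fun i ↦ (ks.getD i default).wt) (fun i m ↦ Real.cos ((m : ℝ) * (π * (ks.getD i default).len / a)))
      (fun j m ↦ Real.cos ((m : ℝ) * (π * (ks.getD j default).len / a))) (fun _ _ ↦ Real.abs_cos_le_one _)
      (fun _ _ ↦ Real.abs_cos_le_one _) ks.length hs m₀ B₄]
    refine Finset.sum_congr rfl fun i _ ↦ Finset.sum_congr rfl fun j _ ↦ ?_
    rw [tsum_coscos_far _ _ hs m₀ B₄]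
  rw [e]
  refine mem_sumBox ks.length fun i hi ↦ mem_sumBox ks.length fun j hj ↦ ?_
  have hp := mem_trigPairList hS hC hB₄ hs hK hKe hν hL hi hj
  have hm := MI.mem_divNat (MI.mem_mul hS (MI.mem_mul hS (hC.wts i hi) (hC.wts j hj)) (MI.mem_add hp.1.1 hp.2.1))
    (n := 2) (by norm_num)
  exact Encl.mem_of_eq hm (by push_cast; ring)

/-- ★ `far33 ∋ farSum (3,3)`. -/
theorem mem_far33 (hS : 0 < S) (hks : PrimeData a ks) (hC : ConstsValid S a ks C) {Ke ke m₀ B₄ s K J ν : ℕ} (hB₄ : 1 ≤ B₄)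
    (hs : 2 ≤ s) (hK : 1 ≤ K) (hKe : Even K) (hν : ν ≠ 0) {L : List ((MI × MI) × (MI × MI))}
    (hL : trigPairList S Ke ke C ks.length m₀ B₄ s K J ν = some L) :
    MI.mem S (farSum a m₀ B₄ 3 3 s) (pairSum S C.wts L ks.length combSS) := by
  have e : farSum a m₀ B₄ 3 3 s = ∑ i ∈ Finset.range ks.length, ∑ j ∈ Finset.range ks.length,
      (ks.getD i default).wt * (ks.getD j default).wt *
        (((∑' k : ℕ, Real.cos ((B₄ + k : ℕ) * (π * (ks.getD i default).len / a - π * (ks.getD j default).len / a))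
              * ((m₀ : ℝ) / ((B₄ + k : ℕ) : ℝ)) ^ s)
          - ∑' k : ℕ, Real.cos ((B₄ + k : ℕ) * (π * (ks.getD i default).len / a + π * (ks.getD j default).len / a))
              * ((m₀ : ℝ) / ((B₄ + k : ℕ) : ℝ)) ^ s) / 2) := by
    unfold farSum
    have hterm : ∀ k : ℕ, tagT a 3 (B₄ + k) * tagT a 3 (B₄ + k) * ((m₀ : ℝ) / ((B₄ + k : ℕ) : ℝ)) ^ s
        = (∑ i ∈ Finset.range ks.length, (ks.getD i default).wt * Real.sin (((B₄ + k : ℕ) : ℝ) * (π * (ks.getD i default).len / a)))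
          * (∑ j ∈ Finset.range ks.length, (ks.getD j default).wt * Real.sin (((B₄ + k : ℕ) : ℝ) * (π * (ks.getD j default).len / a)))
          * ((m₀ : ℝ) / ((B₄ + k : ℕ) : ℝ)) ^ s := by
      intro k; rw [tagT_three, S_eq hks]
    simp_rw [hterm]
    rw [tsum_double (fun i ↦ (ks.getD i default).wt) (fun i m ↦ Real.sin ((m : ℝ) * (π * (ks.getD i default).len / a)))
      (fun j m ↦ Real.sin ((m : ℝ) * (π * (ks.getD j default).len / a))) (fun _ _ ↦ Real.abs_sin_le_one _)
      (fun _ _ ↦ Real.abs_sin_le_one _) ks.length hs m₀ B₄]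
    refine Finset.sum_congr rfl fun i _ ↦ Finset.sum_congr rfl fun j _ ↦ ?_
    rw [tsum_sinsin_far _ _ hs m₀ B₄]
  rw [e]
  refine mem_sumBox ks.length fun i hi ↦ mem_sumBox ks.length fun j hj ↦ ?_
  have hp := mem_trigPairList hS hC hB₄ hs hK hKe hν hL hi hj
  have hm := MI.mem_divNat (MI.mem_mul hS (MI.mem_mul hS (hC.wts i hi) (hC.wts j hj)) (MI.mem_sub hp.1.1 hp.2.1))
    (n := 2) (by norm_num)
  exact Encl.mem_of_eq hm (by push_cast; ring)

/-- ★ `far23 ∋ farSum (2,3)` (`(−C)·S`: minus the `cs` combination). -/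
theorem mem_far23 (hS : 0 < S) (hks : PrimeData a ks) (hC : ConstsValid S a ks C) {Ke ke m₀ B₄ s K J ν : ℕ} (hB₄ : 1 ≤ B₄)
    (hs : 2 ≤ s) (hK : 1 ≤ K) (hKe : Even K) (hν : ν ≠ 0) {L : List ((MI × MI) × (MI × MI))}
    (hL : trigPairList S Ke ke C ks.length m₀ B₄ s K J ν = some L) :
    MI.mem S (farSum a m₀ B₄ 2 3 s) ((pairSum S C.wts L ks.length combCS).neg) := by
  have e : farSum a m₀ B₄ 2 3 s = -(∑ i ∈ Finset.range ks.length, ∑ j ∈ Finset.range ks.length,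
      (ks.getD i default).wt * (ks.getD j default).wt *
        (((∑' k : ℕ, Real.sin ((B₄ + k : ℕ) * (π * (ks.getD i default).len / a + π * (ks.getD j default).len / a))
              * ((m₀ : ℝ) / ((B₄ + k : ℕ) : ℝ)) ^ s)
          - ∑' k : ℕ, Real.sin ((B₄ + k : ℕ) * (π * (ks.getD i default).len / a - π * (ks.getD j default).len / a))
              * ((m₀ : ℝ) / ((B₄ + k : ℕ) : ℝ)) ^ s) / 2)) := by
    unfold farSum
    have hterm : ∀ k : ℕ, tagT a 2 (B₄ + k) * tagT a 3 (B₄ + k) * ((m₀ : ℝ) / ((B₄ + k : ℕ) : ℝ)) ^ s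
        = -((∑ i ∈ Finset.range ks.length, (ks.getD i default).wt * Real.cos (((B₄ + k : ℕ) : ℝ) * (π * (ks.getD i default).len / a)))
          * (∑ j ∈ Finset.range ks.length, (ks.getD j default).wt * Real.sin (((B₄ + k : ℕ) : ℝ) * (π * (ks.getD j default).len / a)))
          * ((m₀ : ℝ) / ((B₄ + k : ℕ) : ℝ)) ^ s) := by
      intro k; rw [tagT_two, tagT_three, C_eq hks, S_eq hks]; ring
    simp_rw [hterm]
    rw [tsum_neg, tsum_double (fun i ↦ (ks.getD i default).wt) (fun i m ↦ Real.cos ((m : ℝ) * (π * (ks.getD i default).len / a)))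
      (fun j m ↦ Real.sin ((m : ℝ) * (π * (ks.getD j default).len / a))) (fun _ _ ↦ Real.abs_cos_le_one _)
      (fun _ _ ↦ Real.abs_sin_le_one _) ks.length hs m₀ B₄]
    congr 1
    refine Finset.sum_congr rfl fun i _ ↦ Finset.sum_congr rfl fun j _ ↦ ?_
    rw [tsum_cossin_far _ _ hs m₀ B₄]
  rw [e]
  refine MI.mem_neg (mem_sumBox ks.length fun i hi ↦ mem_sumBox ks.length fun j hj ↦ ?_)
  have hp := mem_trigPairList hS hC hB₄ hs hK hKe hν hL hi hj
  have hm := MI.mem_divNat (MI.mem_mul hS (MI.mem_mul hS (hC.wts i hi) (hC.wts j hj)) (MI.mem_sub hp.2.2 hp.1.2))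
    (n := 2) (by norm_num)
  exact Encl.mem_of_eq hm (by push_cast; ring)

end CinfHankelR

end Summit.RiemannHypothesis.RiemannHypothesis.Theorems.WeilFormatC
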